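import Literature.NumberTheory.DiophantineGeometry.GenEllValuationMultiplicity
import Mathlib.Algebra.Polynomial.Derivative
import Mathlib.RingTheory.Valuation.Integers
import Mathlib.Tactic.LinearCombination
import HarnessLib

/-!
# [GenEll] Thm. 2.1 on the `D_e` route, FAMILY version `t_c = 1/r + c·r^{k+1}/s`: plane model and the
# SHARP conductor inequality at primes of good reduction

S. Mochizuki, *Arithmetic elliptic curves in general position*, Math. J. Okayama Univ. 52 (2010),
Prop. 1.6 p. 10 (reduced divisor), proof of Thm. 2.1 pp. 12–13 [cite: MochizukiGenEll2010, Prop 1.6 p.10].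
Support file for the route item `GenEllTwo` (stmt-ABC-19679), package W5 (A)+(C) of abc-iut-S6's
GENELLTWO-P1ROUTE note for the FAMILY `t_c` required by OWNER RULING #6 / its amendment (the per-
configuration protection varies the function `t_c`, `c ∈ ℚ^×`); holder / W5 coordinator abc-iut-w5-d045.
The case `c = 1` is `GenEllDeGoodPrimes.lean`; the proofs are the same with `c` threaded through.
Classical; nothing here bears on [IUTchIII] Cor. 3.12.

SETTING (`e = 2k+1`, definition-free): `D_e : s² = 1 − 4r^{2k+1}` (`s = 1 − 2x`, `r^e = x(1−x)`);
`t_c := 1/r + c·r^{k+1}/s = (s + c·r^{k+2})/(r s)`, i.e. `ht : t·(r·s) = s + c·r^{k+2}`; the ramification form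
`N_c := r²s³·dt_c/dr = −s³ + c((k+1)r^{k+2} − 2r^{3k+3})` (`hN`); the fibre polynomial of `t_c` over `b`,
`G^c_b(X) = c²X^{2k+4} + 4b²X^{2k+3} − 8bX^{2k+2} + 4X^{2k+1} − b²X² + 2bX − 1` (leading coefficient `c²`;
`= −((bX−1)²(1−4X^e) − c²X^{e+3})`), given as `g` with `hg : g = …`.

CONTENTS. (A) plane-model identities incl. **`r²s³·∂_rG^c(t,r) = 2c·r^{k+3}·s·N_c`**; the fibre polynomial
(leading coefficient, value, derivative, integral coefficients); (C) at a place with `v 2 = v c = 1`: the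
units `r`, `s`, `rt − 1`, the **sharp inequality** `DeC.valuation_sub_lt_valuation_N_of_gap` (good
reduction of `G^c_b` entering only through the gap conclusion `hgap`, the descent-friendly shape of
`GoodPrime.exists_modulus_val_aeval_lt_val_aeval_derivative`), `DeC.gap_of_splits`, the split form
and `DeC.good_place_dichotomy_of_gap`.
-/

noncomputable section

namespace Literature.NumberTheory.DiophantineGeometry.GenEll

open _root_.Polynomial

/-! ## (A) The plane model of `t_c` on `D_e` -/

section PlaneModel

variable {K : Type*} [CommRing K] (k : ℕ) (c : K)

/-- Plane-model relation for `t_c`: on `s² = 1 − 4r^{2k+1}` with `t·(rs) = s + c·r^{k+2}`,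
`c²r^{2k+4} + 4t²r^{2k+3} − 8t r^{2k+2} + 4r^{2k+1} − t²r² + 2tr − 1 = 0` (from `((rt−1)s)² = c²r^{2k+4}`).
[cite: MochizukiGenEll2010, Prop 1.6 p.10] -/
theorem DeC.planeModel_eq_zero {r s t : K} (hcurve : s ^ 2 = 1 - 4 * r ^ (2 * k + 1))
    (ht : t * (r * s) = s + c * r ^ (k + 2)) :
    c ^ 2 * r ^ (2 * k + 4) + 4 * t ^ 2 * r ^ (2 * k + 3) - 8 * t * r ^ (2 * k + 2)
      + 4 * r ^ (2 * k + 1) - t ^ 2 * r ^ 2 + 2 * t * r - 1 = 0 := by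
  linear_combination (-((r * t - 1) * s + c * r ^ (k + 2))) * ht + (r * t - 1) ^ 2 * hcurve

/-- `G^c_b(r) − G^c_d(r) = (b − d)·r·(1 − 4r^{2k+1})·(2 − (b+d)·r)`. [cite: MochizukiGenEll2010, Prop 1.6 p.10] -/
theorem DeC.fiber_sub_fiber (r b d : K) :
    (c ^ 2 * r ^ (2 * k + 4) + 4 * b ^ 2 * r ^ (2 * k + 3) - 8 * b * r ^ (2 * k + 2)
        + 4 * r ^ (2 * k + 1) - b ^ 2 * r ^ 2 + 2 * b * r - 1) -
      (c ^ 2 * r ^ (2 * k + 4) + 4 * d ^ 2 * r ^ (2 * k + 3) - 8 * d * r ^ (2 * k + 2)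
        + 4 * r ^ (2 * k + 1) - d ^ 2 * r ^ 2 + 2 * d * r - 1) =
      (b - d) * r * (1 - 4 * r ^ (2 * k + 1)) * (2 - (b + d) * r) := by
  ring

/-- `∂G^c/∂t (t, r) = 8t r^{2k+3} − 8r^{2k+2} − 2t r² + 2r = −2c·r^{k+3}s` on the curve.
[cite: MochizukiGenEll2010, Prop 1.6 p.10] -/
theorem DeC.Gt_eq {r s t : K} (hcurve : s ^ 2 = 1 - 4 * r ^ (2 * k + 1))
    (ht : t * (r * s) = s + c * r ^ (k + 2)) :
    8 * t * r ^ (2 * k + 3) - 8 * r ^ (2 * k + 2) - 2 * t * r ^ 2 + 2 * r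
      = -2 * c * r ^ (k + 3) * s := by
  linear_combination (-2 * r * s) * ht + (-2 * r * (1 - r * t)) * hcurve

/-- **`r²s³·∂_rG^c(t,r) = 2c·r^{k+3}·s·N_c` on `D_e`** (`N_c = r²s³·dt_c/dr`), via the derivation
`r²s³∂_r − 2(2k+1)r^{2k+2}s²∂_s + N_c∂_t` killing both defining equations. [cite: MochizukiGenEll2010, Prop 1.6 p.10] -/
theorem DeC.sq_mul_Gr_eq {r s t N : K} (hcurve : s ^ 2 = 1 - 4 * r ^ (2 * k + 1))
    (ht : t * (r * s) = s + c * r ^ (k + 2))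
    (hN : N = -s ^ 3 + c * ((k + 1) * r ^ (k + 2) - 2 * r ^ (3 * k + 3))) :
    r ^ 2 * s ^ 3 * (c ^ 2 * (2 * k + 4) * r ^ (2 * k + 3) + 4 * (2 * k + 3) * t ^ 2 * r ^ (2 * k + 2)
        - 8 * (2 * k + 2) * t * r ^ (2 * k + 1) + 4 * (2 * k + 1) * r ^ (2 * k) - 2 * t ^ 2 * r + 2 * t)
      = 2 * c * r ^ (k + 3) * s * N := by
  have hD : r ^ 2 * s ^ 3 * (t * s - c * (k + 2) * r ^ (k + 1))
      - 2 * (2 * k + 1) * r ^ (2 * k + 2) * s ^ 2 * (r * t - 1) + N * (r * s) = 0 := by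
    linear_combination (r * s ^ 3 - 2 * (2 * k + 1) * r ^ (2 * k + 2) * s) * ht
      - (c * (k + 1) * r ^ (k + 3) * s) * hcurve + (r * s) * hN
  have hGt := DeC.Gt_eq k c hcurve ht
  linear_combination (-N) * hGt + (-((r * t - 1) * s + c * r ^ (k + 2))) * hD
    + (-(r ^ 2 * s ^ 3 * (t * s + c * (k + 2) * r ^ (k + 1))
        - 2 * (2 * k + 1) * r ^ (2 * k + 2) * s ^ 2 * (r * t - 1) + N * (r * s))) * ht
    + (2 * r ^ 2 * s ^ 3 * t * (r * t - 1) + 2 * N * r * (r * t - 1)) * hcurve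

end PlaneModel

/-! ## The fibre polynomial `G^c_b` -/

section Fiber

variable {K : Type*} [Field K] (k : ℕ) {c : K}

/-- The fibre polynomial has leading coefficient `c²` (for `c ≠ 0`). [cite: MochizukiGenEll2010, Prop 1.6 p.10] -/
theorem DeC.fiber_leadingCoeff (hc0 : c ≠ 0) (b : K) {g : K[X]}
    (hg : g = C (c ^ 2) * X ^ (2 * k + 4) + C (4 * b ^ 2) * X ^ (2 * k + 3)
      - C (8 * b) * X ^ (2 * k + 2) + C 4 * X ^ (2 * k + 1) - C (b ^ 2) * X ^ 2 + C (2 * b) * X - 1) :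
    g.leadingCoeff = c ^ 2 := by
  have h : (C (4 * b ^ 2) * X ^ (2 * k + 3) - C (8 * b) * X ^ (2 * k + 2)
      + C 4 * X ^ (2 * k + 1) - C (b ^ 2) * X ^ 2 + C (2 * b) * X - 1 : K[X]).degree
        < (C (c ^ 2) * X ^ (2 * k + 4) : K[X]).degree := by
    rw [degree_C_mul_X_pow _ (pow_ne_zero 2 hc0)]
    have h4 : ((2 * k + 3 : ℕ) : WithBot ℕ) < (2 * k + 4 : ℕ) := by exact_mod_cast (by omega)
    refine lt_of_le_of_lt ?_ h4
    refine (degree_sub_le _ _).trans (max_le ?_ ?_)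
    · refine (degree_add_le _ _).trans (max_le ?_ ?_)
      · refine (degree_sub_le _ _).trans (max_le ?_ ?_)
        · refine (degree_add_le _ _).trans (max_le ?_ ?_)
          · refine (degree_sub_le _ _).trans (max_le ?_ ?_)
            · exact degree_C_mul_X_pow_le _ _
            · exact (degree_C_mul_X_pow_le _ _).trans (by exact_mod_cast (by omega))
          · exact (degree_C_mul_X_pow_le _ _).trans (by exact_mod_cast (by omega))
        · exact (degree_C_mul_X_pow_le _ _).trans (by exact_mod_cast (by omega))
      · exact (degree_C_mul_X_le _).trans (by exact_mod_cast (by omega))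
    · exact degree_one_le.trans (by exact_mod_cast (by omega))
  have h' : g = (C (4 * b ^ 2) * X ^ (2 * k + 3) - C (8 * b) * X ^ (2 * k + 2)
      + C 4 * X ^ (2 * k + 1) - C (b ^ 2) * X ^ 2 + C (2 * b) * X - 1) + C (c ^ 2) * X ^ (2 * k + 4) := by
    rw [hg]; ring
  rw [h', leadingCoeff_add_of_degree_lt h, leadingCoeff_C_mul_X_pow]

/-- The value of the fibre polynomial. [cite: MochizukiGenEll2010, Prop 1.6 p.10] -/
theorem DeC.eval_fiber (b : K) {g : K[X]}
    (hg : g = C (c ^ 2) * X ^ (2 * k + 4) + C (4 * b ^ 2) * X ^ (2 * k + 3)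
      - C (8 * b) * X ^ (2 * k + 2) + C 4 * X ^ (2 * k + 1) - C (b ^ 2) * X ^ 2 + C (2 * b) * X - 1)
    (x : K) :
    g.eval x = c ^ 2 * x ^ (2 * k + 4) + 4 * b ^ 2 * x ^ (2 * k + 3) - 8 * b * x ^ (2 * k + 2)
      + 4 * x ^ (2 * k + 1) - b ^ 2 * x ^ 2 + 2 * b * x - 1 := by
  rw [hg]
  simp [eval_add, eval_sub, eval_mul, eval_pow, eval_X, eval_C]

/-- The fibre polynomial is nonzero (its constant term is `−1`). [cite: MochizukiGenEll2010, Prop 1.6 p.10] -/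
theorem DeC.fiber_ne_zero (b : K) {g : K[X]}
    (hg : g = C (c ^ 2) * X ^ (2 * k + 4) + C (4 * b ^ 2) * X ^ (2 * k + 3)
      - C (8 * b) * X ^ (2 * k + 2) + C 4 * X ^ (2 * k + 1) - C (b ^ 2) * X ^ 2 + C (2 * b) * X - 1) :
    g ≠ 0 := by
  intro h0
  have h := DeC.eval_fiber k b hg 0
  rw [h0, eval_zero] at h
  simp at h

/-- The value of the derivative of the fibre polynomial (`= ∂G^c/∂r (b, x)`).
[cite: MochizukiGenEll2010, Prop 1.6 p.10] -/
theorem DeC.eval_derivative_fiber (b : K) {g : K[X]}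
    (hg : g = C (c ^ 2) * X ^ (2 * k + 4) + C (4 * b ^ 2) * X ^ (2 * k + 3)
      - C (8 * b) * X ^ (2 * k + 2) + C 4 * X ^ (2 * k + 1) - C (b ^ 2) * X ^ 2 + C (2 * b) * X - 1)
    (x : K) :
    (derivative g).eval x = c ^ 2 * (2 * k + 4) * x ^ (2 * k + 3)
      + 4 * (2 * k + 3) * b ^ 2 * x ^ (2 * k + 2) - 8 * (2 * k + 2) * b * x ^ (2 * k + 1)
      + 4 * (2 * k + 1) * x ^ (2 * k) - 2 * b ^ 2 * x + 2 * b := by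
  have e1 : 2 * k + 4 - 1 = 2 * k + 3 := by omega
  have e2 : 2 * k + 3 - 1 = 2 * k + 2 := by omega
  have e3 : 2 * k + 2 - 1 = 2 * k + 1 := by omega
  have e4 : 2 * k + 1 - 1 = 2 * k := by omega
  rw [hg]
  simp only [derivative_add, derivative_sub, derivative_mul, derivative_X_pow, derivative_C,
    derivative_X, derivative_one, zero_mul, zero_add, mul_one, e1, e2, e3, e4,
    eval_add, eval_sub, eval_mul, eval_pow, eval_X, eval_C, sub_zero]
  push_cast
  ring

variable {Γ₀ : Type*} [LinearOrderedCommGroupWithZero Γ₀] (v : Valuation K Γ₀)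

/-- For `v`-integral `c`, `b` the fibre polynomial has `v`-integral coefficients.
[cite: MochizukiGenEll2010, Prop 1.6 p.10] -/
theorem DeC.valuation_coeff_fiber_le_one (hc : v c ≤ 1) {b : K} (hb : v b ≤ 1) {g : K[X]}
    (hg : g = C (c ^ 2) * X ^ (2 * k + 4) + C (4 * b ^ 2) * X ^ (2 * k + 3)
      - C (8 * b) * X ^ (2 * k + 2) + C 4 * X ^ (2 * k + 1) - C (b ^ 2) * X ^ 2 + C (2 * b) * X - 1)
    (n : ℕ) : v (g.coeff n) ≤ 1 := by
  obtain ⟨c₀, hc₀⟩ : ∃ c₀ : v.integer, (c₀ : K) = c := ⟨⟨c, hc⟩, rfl⟩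
  obtain ⟨b₀, hb₀⟩ : ∃ b₀ : v.integer, (b₀ : K) = b := ⟨⟨b, hb⟩, rfl⟩
  obtain ⟨g₀, hg₀⟩ : ∃ g₀ : (v.integer)[X], g₀ = C (c₀ ^ 2) * X ^ (2 * k + 4)
      + C (4 * b₀ ^ 2) * X ^ (2 * k + 3) - C (8 * b₀) * X ^ (2 * k + 2) + C 4 * X ^ (2 * k + 1)
      - C (b₀ ^ 2) * X ^ 2 + C (2 * b₀) * X - 1 := ⟨_, rfl⟩
  have hmap : g = g₀.map v.integer.subtype := by
    rw [hg, hg₀, ← hb₀, ← hc₀]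
    simp [Polynomial.map_sub, Polynomial.map_add, Polynomial.map_mul, Polynomial.map_pow, map_ofNat]
  rw [hmap, coeff_map]
  exact (g₀.coeff n).2

end Fiber

/-! ## (C) Valuations at a point of `D_e` meeting an integral value of `t_c` -/

section GoodPlace

variable {K : Type*} [Field K] {Γ₀ : Type*} [LinearOrderedCommGroupWithZero Γ₀]
  (v : Valuation K Γ₀) (k : ℕ) {c : K}

/-- `v x ≤ 1`, `v y ≤ 1`, `v (x·y) = 1` ⇒ `v x = 1`. [cite: MochizukiGenEll2010, Prop 1.6 p.10] -/
private theorem valuation_eq_one_of_mul' {x y : K} (hx : v x ≤ 1) (hy : v y ≤ 1)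
    (h : v (x * y) = 1) : v x = 1 := by
  refine le_antisymm hx ?_
  calc 1 = v x * v y := by rw [← map_mul, h]
    _ ≤ v x := mul_le_of_le_one_right' hy

/-- On `D_e`, if `v c = 1` and `v t ≤ 1` then `r` is a `v`-unit (a root of `G^c_t`, unit leading
coefficient `c²`, constant term `−1`). [cite: MochizukiGenEll2010, Prop 1.6 p.10] -/
theorem DeC.valuation_r_eq_one (hcv : v c = 1) {r s t : K} (hcurve : s ^ 2 = 1 - 4 * r ^ (2 * k + 1))
    (ht : t * (r * s) = s + c * r ^ (k + 2)) (htv : v t ≤ 1) : v r = 1 := by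
  have hc0 : c ≠ 0 := fun h => by rw [h, map_zero] at hcv; exact zero_ne_one hcv
  obtain ⟨g, hg⟩ : ∃ g : K[X], g = C (c ^ 2) * X ^ (2 * k + 4) + C (4 * t ^ 2) * X ^ (2 * k + 3)
      - C (8 * t) * X ^ (2 * k + 2) + C 4 * X ^ (2 * k + 1) - C (t ^ 2) * X ^ 2 + C (2 * t) * X - 1 :=
    ⟨_, rfl⟩
  have hG := DeC.planeModel_eq_zero k c hcurve ht
  have hr : v r ≤ 1 := by
    refine valuation_le_one_of_isRoot v (DeC.valuation_coeff_fiber_le_one k v hcv.le htv hg)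
      (by rw [DeC.fiber_leadingCoeff k hc0 t hg, map_pow, hcv, one_pow]) ?_
    rw [IsRoot.def, DeC.eval_fiber k t hg]
    exact hG
  have hQ : r * (c ^ 2 * r ^ (2 * k + 3) + 4 * t ^ 2 * r ^ (2 * k + 2) - 8 * t * r ^ (2 * k + 1)
      + 4 * r ^ (2 * k) - t ^ 2 * r + 2 * t) = 1 := by
    linear_combination hG
  have hn : ∀ n : ℕ, v (n : K) ≤ 1 := fun n => (v.mem_integer_iff _).1 (natCast_mem v.integer n)
  have h4 : v (4 : K) ≤ 1 := by exact_mod_cast hn 4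
  refine valuation_eq_one_of_mul' v hr ?_ (by rw [hQ, map_one])
  refine v.map_add_le (v.map_sub_le (v.map_add_le (v.map_sub_le (v.map_add_le ?_ ?_) ?_) ?_) ?_) ?_
  · rw [map_mul, map_pow, map_pow, hcv, one_pow, one_mul]; exact pow_le_one' hr _
  · rw [map_mul, map_mul, map_pow, map_pow]
    exact mul_le_one' (mul_le_one' h4 (pow_le_one' htv _)) (pow_le_one' hr _)
  · rw [map_mul, map_mul, map_pow]
    exact mul_le_one' (mul_le_one' (by exact_mod_cast hn 8) htv) (pow_le_one' hr _)
  · rw [map_mul, map_pow]; exact mul_le_one' h4 (pow_le_one' hr _)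
  · rw [map_mul, map_pow]; exact mul_le_one' (pow_le_one' htv _) hr
  · rw [map_mul]; exact mul_le_one' (by exact_mod_cast hn 2) htv

/-- On `D_e`, if `v c = 1` and `v t ≤ 1` then `s` and `rt − 1` are `v`-units (`(rt−1)s = c·r^{k+2}`).
[cite: MochizukiGenEll2010, Prop 1.6 p.10] -/
theorem DeC.valuation_s_eq_one (hcv : v c = 1) {r s t : K} (hcurve : s ^ 2 = 1 - 4 * r ^ (2 * k + 1))
    (ht : t * (r * s) = s + c * r ^ (k + 2)) (htv : v t ≤ 1) :
    v s = 1 ∧ v (r * t - 1) = 1 := by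
  have hr := DeC.valuation_r_eq_one v k hcv hcurve ht htv
  have h4 : v (4 : K) ≤ 1 := by exact_mod_cast (v.mem_integer_iff _).1 (natCast_mem v.integer 4)
  have hs2 : v (s ^ 2) ≤ 1 := by
    rw [hcurve]
    refine v.map_sub_le (le_of_eq v.map_one) ?_
    rw [map_mul, map_pow]
    exact mul_le_one' h4 (pow_le_one' hr.le _)
  have hs : v s ≤ 1 := by
    by_contra h
    push Not at h
    have : 1 < v (s ^ 2) := by
      rw [map_pow, pow_two]
      exact one_lt_mul'' h h
    exact (lt_irrefl _) (this.trans_le hs2)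
  have hrt : v (r * t - 1) ≤ 1 :=
    v.map_sub_le (by rw [map_mul]; exact mul_le_one' hr.le htv) (le_of_eq v.map_one)
  have hprod : (r * t - 1) * s = c * r ^ (k + 2) := by linear_combination ht
  have hunit : v ((r * t - 1) * s) = 1 := by rw [hprod, map_mul, map_pow, hcv, hr, one_pow, mul_one]
  exact ⟨valuation_eq_one_of_mul' v hs hrt (by rwa [mul_comm]), valuation_eq_one_of_mul' v hrt hs hunit⟩

/-- **The sharp inequality at a good place for `t_c`, descent-friendly form.** `v 2 = 1`, `v c = 1`,
`b` integral, the fibre polynomial `G^c_b` satisfying the gap conclusion `hgap` at `v`, `N_c ≠ 0` and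
`v (t − b) < 1` ⇒ `v (t − b) < v N_c` (`ord_v (t_c(P) − b) ≥ ord_v N_c(P) + 1`).
[cite: MochizukiGenEll2010, Prop 1.6 p.10] -/
theorem DeC.valuation_sub_lt_valuation_N_of_gap (hv2 : v 2 = 1) (hcv : v c = 1) {r s t N b : K}
    (hcurve : s ^ 2 = 1 - 4 * r ^ (2 * k + 1)) (ht : t * (r * s) = s + c * r ^ (k + 2))
    (hN : N = -s ^ 3 + c * ((k + 1) * r ^ (k + 2) - 2 * r ^ (3 * k + 3))) (hN0 : N ≠ 0)
    (hb : v b ≤ 1) {g : K[X]}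
    (hg : g = C (c ^ 2) * X ^ (2 * k + 4) + C (4 * b ^ 2) * X ^ (2 * k + 3)
      - C (8 * b) * X ^ (2 * k + 2) + C 4 * X ^ (2 * k + 1) - C (b ^ 2) * X ^ 2 + C (2 * b) * X - 1)
    (hgap : ∀ ρ : K, v ρ ≤ 1 → g.eval ρ ≠ 0 → v (g.eval ρ) < 1 →
      v (g.eval ρ) < v ((derivative g).eval ρ))
    (htb : v (t - b) < 1) : v (t - b) < v N := by
  by_cases htb0 : t - b = 0
  · rw [htb0, map_zero]
    exact zero_lt_iff.2 ((v.ne_zero_iff).2 hN0)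
  have htv : v t ≤ 1 := by
    have : t = (t - b) + b := by ring
    rw [this]
    exact v.map_add_le htb.le hb
  have hr := DeC.valuation_r_eq_one v k hcv hcurve ht htv
  obtain ⟨hs, hrt⟩ := DeC.valuation_s_eq_one v k hcv hcurve ht htv
  have hG := DeC.planeModel_eq_zero k c hcurve ht
  have hgr : g.eval r = (b - t) * r * (1 - 4 * r ^ (2 * k + 1)) * (2 - (b + t) * r) := by
    rw [DeC.eval_fiber k b hg]
    linear_combination DeC.fiber_sub_fiber k c r b t + hG
  have hunit : v (2 - (b + t) * r) = 1 := by
    have e : 2 - (b + t) * r = -(2 * (r * t - 1)) + (t - b) * r := by ring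
    rw [e, v.map_add_eq_of_lt_left]
    · simp only [v.map_neg, map_mul, hv2, hrt, one_mul]
    · simp only [v.map_neg, map_mul, hv2, hrt, hr, mul_one]
      exact htb
  have hvg : v (g.eval r) = v (t - b) := by
    rw [hgr, map_mul, map_mul, map_mul, hunit, mul_one, ← hcurve, map_pow, hs, one_pow, mul_one,
      hr, mul_one, v.map_sub_swap]
  have hg0 : g.eval r ≠ 0 := by
    intro h0
    rw [h0, map_zero] at hvg
    exact htb0 ((v.zero_iff).1 hvg.symm)
  have hgap' := hgap r hr.le hg0 (by rw [hvg]; exact htb)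
  rw [hvg, DeC.eval_derivative_fiber k b hg] at hgap'
  have hdiff : c ^ 2 * (2 * k + 4) * r ^ (2 * k + 3) + 4 * (2 * k + 3) * t ^ 2 * r ^ (2 * k + 2)
        - 8 * (2 * k + 2) * t * r ^ (2 * k + 1) + 4 * (2 * k + 1) * r ^ (2 * k) - 2 * t ^ 2 * r + 2 * t
      = (c ^ 2 * (2 * k + 4) * r ^ (2 * k + 3) + 4 * (2 * k + 3) * b ^ 2 * r ^ (2 * k + 2)
        - 8 * (2 * k + 2) * b * r ^ (2 * k + 1) + 4 * (2 * k + 1) * r ^ (2 * k) - 2 * b ^ 2 * r + 2 * b)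
        + (t - b) * (4 * (2 * k + 3) * (t + b) * r ^ (2 * k + 2) - 8 * (2 * k + 2) * r ^ (2 * k + 1)
          - 2 * (t + b) * r + 2) := by
    ring
  have hM : v (4 * (2 * k + 3) * (t + b) * r ^ (2 * k + 2) - 8 * (2 * k + 2) * r ^ (2 * k + 1)
      - 2 * (t + b) * r + 2) ≤ 1 := by
    have hn : ∀ n : ℕ, v (n : K) ≤ 1 := fun n => (v.mem_integer_iff _).1 (natCast_mem v.integer n)
    have h4 : v (4 : K) ≤ 1 := by exact_mod_cast hn 4
    have h8 : v (8 : K) ≤ 1 := by exact_mod_cast hn 8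
    have h2 : v (2 : K) ≤ 1 := by exact_mod_cast hn 2
    have h23 : v (2 * k + 3 : K) ≤ 1 := by exact_mod_cast hn (2 * k + 3)
    have h22 : v (2 * k + 2 : K) ≤ 1 := by exact_mod_cast hn (2 * k + 2)
    have htb' : v (t + b) ≤ 1 := v.map_add_le htv hb
    refine v.map_add_le (v.map_sub_le (v.map_sub_le ?_ ?_) ?_) h2
    · rw [map_mul, map_mul, map_mul, map_pow]
      exact mul_le_one' (mul_le_one' (mul_le_one' h4 h23) htb') (pow_le_one' hr.le _)
    · rw [map_mul, map_mul, map_pow]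
      exact mul_le_one' (mul_le_one' h8 h22) (pow_le_one' hr.le _)
    · rw [map_mul, map_mul]
      exact mul_le_one' (mul_le_one' h2 htb') hr.le
  have hGr : v (c ^ 2 * (2 * k + 4) * r ^ (2 * k + 3) + 4 * (2 * k + 3) * t ^ 2 * r ^ (2 * k + 2)
        - 8 * (2 * k + 2) * t * r ^ (2 * k + 1) + 4 * (2 * k + 1) * r ^ (2 * k) - 2 * t ^ 2 * r + 2 * t)
      = v (c ^ 2 * (2 * k + 4) * r ^ (2 * k + 3) + 4 * (2 * k + 3) * b ^ 2 * r ^ (2 * k + 2)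
        - 8 * (2 * k + 2) * b * r ^ (2 * k + 1) + 4 * (2 * k + 1) * r ^ (2 * k) - 2 * b ^ 2 * r
        + 2 * b) := by
    rw [hdiff, v.map_add_eq_of_lt_left]
    rw [map_mul]
    exact lt_of_le_of_lt (mul_le_of_le_one_right' hM) hgap'
  have hkey := DeC.sq_mul_Gr_eq k c hcurve ht hN
  have hvN : v (c ^ 2 * (2 * k + 4) * r ^ (2 * k + 3) + 4 * (2 * k + 3) * t ^ 2 * r ^ (2 * k + 2)
        - 8 * (2 * k + 2) * t * r ^ (2 * k + 1) + 4 * (2 * k + 1) * r ^ (2 * k) - 2 * t ^ 2 * r + 2 * t)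
      = v N := by
    have h1 := congrArg v hkey
    rw [map_mul, map_mul, map_pow, map_pow, hr, hs, one_pow, one_pow, one_mul, one_mul] at h1
    rw [h1, map_mul, map_mul, map_mul, map_mul, hv2, hcv, map_pow, hr, one_pow, hs, mul_one, mul_one,
      one_mul, one_mul]
  rw [← hvN, hGr]
  exact hgap'

/-- The split good-reduction hypotheses for `G^c_b` give the gap conclusion (`v c = 1`, `b` integral).
[cite: MochizukiGenEll2010, Prop 1.6 p.10] -/
theorem DeC.gap_of_splits (hcv : v c = 1) {b : K} (hb : v b ≤ 1) {g : K[X]}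
    (hg : g = C (c ^ 2) * X ^ (2 * k + 4) + C (4 * b ^ 2) * X ^ (2 * k + 3)
      - C (8 * b) * X ^ (2 * k + 2) + C 4 * X ^ (2 * k + 1) - C (b ^ 2) * X ^ 2 + C (2 * b) * X - 1)
    (hsplit : g.Splits) (hsep : ∀ a ∈ g.roots, ∀ a' ∈ g.roots, a ≠ a' → v (a - a') = 1)
    (htame : ∀ a ∈ g.roots, v (g.rootMultiplicity a : K) = 1) :
    ∀ ρ : K, v ρ ≤ 1 → g.eval ρ ≠ 0 → v (g.eval ρ) < 1 →
      v (g.eval ρ) < v ((derivative g).eval ρ) := by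
  intro ρ hρ hg0 hlt
  have hc0 : c ≠ 0 := fun h => by rw [h, map_zero] at hcv; exact zero_ne_one hcv
  have hlc : v g.leadingCoeff = 1 := by
    rw [DeC.fiber_leadingCoeff k hc0 b hg, map_pow, hcv, one_pow]
  have hint : ∀ a ∈ g.roots, v a ≤ 1 := fun a ha =>
    valuation_le_one_of_isRoot v (DeC.valuation_coeff_fiber_le_one k v hcv.le hb hg) hlc
      ((mem_roots (DeC.fiber_ne_zero k b hg)).1 ha)
  exact (valuation_eval_lt_valuation_eval_derivative v hsplit hlc hint hsep htame hρ hg0 hlt).2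

/-- **The sharp inequality for `t_c`, split hypotheses** (`G^c_b` splits, roots pairwise distinct
modulo `v`, multiplicities `v`-units): `v (t − b) < 1 ⇒ v (t − b) < v N_c`.
[cite: MochizukiGenEll2010, Prop 1.6 p.10] -/
theorem DeC.valuation_sub_lt_valuation_N (hv2 : v 2 = 1) (hcv : v c = 1) {r s t N b : K}
    (hcurve : s ^ 2 = 1 - 4 * r ^ (2 * k + 1)) (ht : t * (r * s) = s + c * r ^ (k + 2))
    (hN : N = -s ^ 3 + c * ((k + 1) * r ^ (k + 2) - 2 * r ^ (3 * k + 3))) (hN0 : N ≠ 0)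
    (hb : v b ≤ 1) {g : K[X]}
    (hg : g = C (c ^ 2) * X ^ (2 * k + 4) + C (4 * b ^ 2) * X ^ (2 * k + 3)
      - C (8 * b) * X ^ (2 * k + 2) + C 4 * X ^ (2 * k + 1) - C (b ^ 2) * X ^ 2 + C (2 * b) * X - 1)
    (hsplit : g.Splits) (hsep : ∀ a ∈ g.roots, ∀ a' ∈ g.roots, a ≠ a' → v (a - a') = 1)
    (htame : ∀ a ∈ g.roots, v (g.rootMultiplicity a : K) = 1)
    (htb : v (t - b) < 1) : v (t - b) < v N :=
  DeC.valuation_sub_lt_valuation_N_of_gap v k hv2 hcv hcurve ht hN hN0 hb hg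
    (DeC.gap_of_splits v k hcv hb hg hsplit hsep htame) htb

/-- **Dichotomy at a good place for `t_c`** (descent-friendly hypotheses; `hconv` = the converse
direction, W5c): EITHER `t` meets exactly one `b ∈ B`, with `v (t − b) < v N_c` and all other `t − b'`
units, OR `t` meets no `b ∈ B` and `1 ≤ v N_c`. [cite: MochizukiGenEll2010, Prop 1.6 p.10] -/
theorem DeC.good_place_dichotomy_of_gap (hv2 : v 2 = 1) (hcv : v c = 1) {r s t N : K}
    (hcurve : s ^ 2 = 1 - 4 * r ^ (2 * k + 1)) (ht : t * (r * s) = s + c * r ^ (k + 2))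
    (hN : N = -s ^ 3 + c * ((k + 1) * r ^ (k + 2) - 2 * r ^ (3 * k + 3))) (hN0 : N ≠ 0)
    (B : Finset K) (hB : ∀ b ∈ B, v b ≤ 1) (hBsep : ∀ b ∈ B, ∀ b' ∈ B, b ≠ b' → v (b - b') = 1)
    (g : K → K[X])
    (hg : ∀ b ∈ B, g b = C (c ^ 2) * X ^ (2 * k + 4) + C (4 * b ^ 2) * X ^ (2 * k + 3)
      - C (8 * b) * X ^ (2 * k + 2) + C 4 * X ^ (2 * k + 1) - C (b ^ 2) * X ^ 2 + C (2 * b) * X - 1)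
    (hgap : ∀ b ∈ B, ∀ ρ : K, v ρ ≤ 1 → (g b).eval ρ ≠ 0 → v ((g b).eval ρ) < 1 →
      v ((g b).eval ρ) < v ((derivative (g b)).eval ρ))
    (hconv : v N < 1 → ∃ b ∈ B, v (t - b) < 1) :
    (∃ b ∈ B, v (t - b) < 1 ∧ v (t - b) < v N ∧ ∀ b' ∈ B, b' ≠ b → v (t - b') = 1) ∨
      ((∀ b ∈ B, 1 ≤ v (t - b)) ∧ 1 ≤ v N) := by
  by_cases h : ∃ b ∈ B, v (t - b) < 1
  · obtain ⟨b, hbB, htb⟩ := h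
    refine Or.inl ⟨b, hbB, htb, ?_, fun b' hb' hne => ?_⟩
    · exact DeC.valuation_sub_lt_valuation_N_of_gap v k hv2 hcv hcurve ht hN hN0 (hB b hbB) (hg b hbB)
        (hgap b hbB) htb
    · exact valuation_sub_eq_one_of_lt v htb (hBsep b hbB b' hb' (Ne.symm hne))
  · push Not at h
    refine Or.inr ⟨h, ?_⟩
    by_contra hN1
    push Not at hN1
    obtain ⟨b, hbB, htb⟩ := hconv hN1
    exact (lt_irrefl _) ((h b hbB).trans_lt htb)

end GoodPlace

end Literature.NumberTheory.DiophantineGeometry.GenEll
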